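import Summits.QuantumFields.QCD.Theorems.SpectralDefectExtinctionTipPricingWallBlockDecay
import Summits.QuantumFields.QCD.Theorems.SpectralDefectExtinctionTipPricingWallBlockGapHalfFlux

/-!
# Lattice Schur-complement locality: auxiliary lemmas (for lemma G6L of the modular cell–wall template)

Helpers for `schur_lattice_locality` (file `…TipPricingSchurLatticeLocality.lean`; sub-goal G6L of crux
stmt-QuantumFields-8967, `Summit.QuantumFields.QCD.Theses.SpectralDefectExtinction.TipPricing`, line `hermitian-flow-coarea`,
lead c2, consumed by the assembly of stub `stub_spreadOfCells`).
* (1) `H = Γ₅ D_W(U, −δ, 1)` has the entries of `D_W` up to the signs `Γ₅ = diag(1,1,−1,−1)` (`schurLoc_H_apply`), so it is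
  nearest-neighbour with off-site absolute row/column sums `≤ 96` (`schurLoc_rowSum_le`, `schurLoc_colSum_le`), and the abstract
  coercive Combes–Thomas bound of the tree (`coercive_combes_thomas`) gives, for every principal block over the quark indices of a
  site set inside an embedded box `c + {−R..R}⁴` (`2R+1 < n`) with a norm gap `g ∈ (0,1]`, invertibility and
  `|block⁻¹_{pq}| ≤ (2/g) e^{−(g/400)·dist}` in the box sup-distance (`schurLoc_block_inv_decay`, the `Γ₅`-twisted twin of
  `wallBlock_inv_decay`; the `Fintype`/`DecidableEq` instances of the block index type are parameters, so that it applies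
  verbatim to the subtypes of the stub).
* (2) Lattice geometry of the cell–collar tiling: torus adjacency inside the big box is lattice adjacency of box coordinates
  (`schurLoc_latticeAdj`); a point of an extended cell adjacent to ANOTHER extended cell lies on the outer face of its cell
  (`schurLoc_outerFace`); a point adjacent to a cell core lies within sup-distance `ℓ+1` of that cell's centre
  (`schurLoc_cellAdjacent`); hence such pairs are `≥ W − 1` apart (`schurLoc_supDist_ge`); at most `12(2R+1)⁴` quark indices sit
  over an embedded box (`schurLoc_card_le`).
* (3) Block-diagonal algebra over a `Σ`-type (`schurLoc_sum_sigma_blockDiagonal'` and two index lemmas).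
Supports stmt-QuantumFields-8967 (helper; closes no item).
-/

noncomputable section

namespace Summit.QuantumFields.QCD.Cruxes.TipPricing.ModularTemplate

open Matrix
open Literature.MathematicalPhysics.QuantumLattice Literature.MathematicalPhysics.QuantumFieldTheory
  Literature.Probability.LatticeModels
open Summit.QuantumFields.QCD.Theorems.ExtinctionBuildsQCD.Negative
open scoped BigOperators

open Summit.QuantumFields.QCD.Cruxes.ExtinctionBuildsQCD.CleanReferenceDeterminantLocality (coercive_combes_thomas)

variable {n : ℕ} [NeZero n]

/-! ### (1) Entries of `H = Γ₅ D_W(U, −δ, 1)` and Combes–Thomas for its principal blocks -/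

/-- `H = Γ₅ D_W` entrywise: `H p q = ε_{spin p} · (D_W) p q` with `ε = (1, 1, −1, −1)`. -/
theorem schurLoc_H_apply (U : GaugeConfig 4 n SU3) (δ : ℝ) (p q : TorusSite 4 n × Fin 3 × Fin 4) :
    (spinorLift gammaFive * wilsonDirac (fundamentalRep (Fin 3)) U (-δ) 1 :
      Matrix (TorusSite 4 n × Fin 3 × Fin 4) (TorusSite 4 n × Fin 3 × Fin 4) ℂ) p q =
      (![1, 1, -1, -1] : Fin 4 → ℂ) p.2.2 * wilsonDirac (fundamentalRep (Fin 3)) U (-δ) 1 p q := by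
  rw [spinorLift_gammaFive_eq_diagonal, diagonal_mul]

/-- `‖H p q‖ = ‖(D_W) p q‖`. -/
theorem schurLoc_norm_H_apply (U : GaugeConfig 4 n SU3) (δ : ℝ) (p q : TorusSite 4 n × Fin 3 × Fin 4) :
    ‖(spinorLift gammaFive * wilsonDirac (fundamentalRep (Fin 3)) U (-δ) 1 :
      Matrix (TorusSite 4 n × Fin 3 × Fin 4) (TorusSite 4 n × Fin 3 × Fin 4) ℂ) p q‖ =
      ‖wilsonDirac (fundamentalRep (Fin 3)) U (-δ) 1 p q‖ := by
  rw [schurLoc_H_apply, norm_mul]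
  obtain ⟨x, a, α⟩ := p
  fin_cases α <;> simp

/-- A non-zero entry of `H` joins equal or nearest-neighbour sites. -/
theorem schurLoc_H_hop (U : GaugeConfig 4 n SU3) (δ : ℝ) (p q : TorusSite 4 n × Fin 3 × Fin 4)
    (h : (spinorLift gammaFive * wilsonDirac (fundamentalRep (Fin 3)) U (-δ) 1 :
      Matrix (TorusSite 4 n × Fin 3 × Fin 4) (TorusSite 4 n × Fin 3 × Fin 4) ℂ) p q ≠ 0) :
    p.1 = q.1 ∨ ∃ μ : Fin 4, q.1 = Site.shift p.1 μ ∨ p.1 = Site.shift q.1 μ := by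
  refine wallDecay_wilsonDirac_hop U (-δ) p q fun h0 => h ?_
  rw [schurLoc_H_apply, h0, mul_zero]

/-- Off-site row sums of `H` over any finset of indices of a site-predicate subtype are `≤ 96`. -/
theorem schurLoc_rowSum_le (U : GaugeConfig 4 n SU3) (δ : ℝ) {P : TorusSite 4 n × Fin 3 × Fin 4 → Prop}
    (p : TorusSite 4 n × Fin 3 × Fin 4) (s : Finset {q : TorusSite 4 n × Fin 3 × Fin 4 // P q})
    (hs : ∀ q ∈ s, p.1 ≠ q.1.1) :
    ∑ q ∈ s, ‖(spinorLift gammaFive * wilsonDirac (fundamentalRep (Fin 3)) U (-δ) 1 :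
      Matrix (TorusSite 4 n × Fin 3 × Fin 4) (TorusSite 4 n × Fin 3 × Fin 4) ℂ) p q.1‖ ≤ 96 := by
  have hρ : ∀ g : SU3, fundamentalRep (Fin 3) g ∈ Matrix.unitaryGroup (Fin 3) ℂ :=
    fundamentalRep_mem_unitaryGroup
  calc ∑ q ∈ s, ‖(spinorLift gammaFive * wilsonDirac (fundamentalRep (Fin 3)) U (-δ) 1 :
      Matrix (TorusSite 4 n × Fin 3 × Fin 4) (TorusSite 4 n × Fin 3 × Fin 4) ℂ) p q.1‖
      = ∑ q ∈ s.map (Function.Embedding.subtype _), ‖wilsonDirac (fundamentalRep (Fin 3)) U (-δ) 1 p q‖ := by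
        rw [Finset.sum_map]
        exact Finset.sum_congr rfl fun q _ => schurLoc_norm_H_apply U δ p q.1
    _ ≤ ∑ q ∈ Finset.univ.filter (fun q : TorusSite 4 n × Fin 3 × Fin 4 => p.1 ≠ q.1),
          ‖wilsonDirac (fundamentalRep (Fin 3)) U (-δ) 1 p q‖ := by
        refine Finset.sum_le_sum_of_subset_of_nonneg (fun q hq => ?_) fun _ _ _ => norm_nonneg _
        rw [Finset.mem_map] at hq
        obtain ⟨q', hq', rfl⟩ := hq
        exact Finset.mem_filter.2 ⟨Finset.mem_univ _, hs q' hq'⟩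
    _ ≤ 32 * ((3 : ℕ) : ℝ) :=
        wilsonDirac_offsite_rowSum_le (fundamentalRep (Fin 3)) hρ U (-δ) p _ fun _ h => h
    _ = 96 := by norm_num

/-- Off-site column sums of `H` over any finset of indices of a site-predicate subtype are `≤ 96`. -/
theorem schurLoc_colSum_le (U : GaugeConfig 4 n SU3) (δ : ℝ) {P : TorusSite 4 n × Fin 3 × Fin 4 → Prop}
    (q : TorusSite 4 n × Fin 3 × Fin 4) (s : Finset {p : TorusSite 4 n × Fin 3 × Fin 4 // P p})
    (hs : ∀ p ∈ s, p.1.1 ≠ q.1) :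
    ∑ p ∈ s, ‖(spinorLift gammaFive * wilsonDirac (fundamentalRep (Fin 3)) U (-δ) 1 :
      Matrix (TorusSite 4 n × Fin 3 × Fin 4) (TorusSite 4 n × Fin 3 × Fin 4) ℂ) p.1 q‖ ≤ 96 := by
  have hρ : ∀ g : SU3, fundamentalRep (Fin 3) g ∈ Matrix.unitaryGroup (Fin 3) ℂ :=
    fundamentalRep_mem_unitaryGroup
  calc ∑ p ∈ s, ‖(spinorLift gammaFive * wilsonDirac (fundamentalRep (Fin 3)) U (-δ) 1 :
      Matrix (TorusSite 4 n × Fin 3 × Fin 4) (TorusSite 4 n × Fin 3 × Fin 4) ℂ) p.1 q‖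
      = ∑ p ∈ s.map (Function.Embedding.subtype _), ‖wilsonDirac (fundamentalRep (Fin 3)) U (-δ) 1 p q‖ := by
        rw [Finset.sum_map]
        exact Finset.sum_congr rfl fun p _ => schurLoc_norm_H_apply U δ p.1 q
    _ ≤ ∑ p ∈ Finset.univ.filter (fun p : TorusSite 4 n × Fin 3 × Fin 4 => p.1 ≠ q.1),
          ‖wilsonDirac (fundamentalRep (Fin 3)) U (-δ) 1 p q‖ := by
        refine Finset.sum_le_sum_of_subset_of_nonneg (fun p hp => ?_) fun _ _ _ => norm_nonneg _
        rw [Finset.mem_map] at hp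
        obtain ⟨p', hp', rfl⟩ := hp
        exact Finset.mem_filter.2 ⟨Finset.mem_univ _, hs p' hp'⟩
    _ ≤ 32 * ((3 : ℕ) : ℝ) :=
        wilsonDirac_offsite_colSum_le (fundamentalRep (Fin 3)) hρ U (-δ) q _ fun _ h => h
    _ = 96 := by norm_num

-- adapted from Theorems/SpectralDefectExtinctionTipPricingWallBlockDecay.lean (`wallBlock_inv_decay`)

/-- **Combes–Thomas decay of the inverse of a coercive principal block of `H = Γ₅ D_W(U, −δ, 1)`** over the quark indices
of a site set inside an embedded box `c + {−R..R}⁴` (`2R+1 < n`), in the box-coordinate sup-distance: norm gap `g ∈ (0,1]`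
⇒ invertible and `|block⁻¹_{pq}| ≤ (2/g)·e^{−(g/400)·dist}`. [folklore] -/
theorem schurLoc_block_inv_decay (U : GaugeConfig 4 n SU3) (δ : ℝ) (c : Fin 4 → ℤ) (R : ℕ) (hR : 2 * R + 1 < n)
    (P : TorusSite 4 n → Prop) [Fintype {p : TorusSite 4 n × Fin 3 × Fin 4 // P p.1}]
    [DecidableEq {p : TorusSite 4 n × Fin 3 × Fin 4 // P p.1}]
    (hP : ∀ x, P x → ∃ y : Fin 4 → ℤ, y ∈ box 4 R ∧ Torus.proj n (c + y) = x) {g : ℝ} (hg : 0 < g) (hg1 : g ≤ 1)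
    (hgap : ∀ v : {p : TorusSite 4 n × Fin 3 × Fin 4 // P p.1} → ℂ, g ^ 2 * ∑ i, ‖v i‖ ^ 2 ≤
      ∑ i, ‖(((spinorLift gammaFive * wilsonDirac (fundamentalRep (Fin 3)) U (-δ) 1).submatrix
        (Subtype.val : {p : TorusSite 4 n × Fin 3 × Fin 4 // P p.1} → _) Subtype.val) *ᵥ v) i‖ ^ 2) :
    IsUnit (((spinorLift gammaFive * wilsonDirac (fundamentalRep (Fin 3)) U (-δ) 1).submatrix
        (Subtype.val : {p : TorusSite 4 n × Fin 3 × Fin 4 // P p.1} → _) Subtype.val).det) ∧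
      ∀ (p q : {p : TorusSite 4 n × Fin 3 × Fin 4 // P p.1}) (yp yq : Fin 4 → ℤ), yp ∈ box 4 R → yq ∈ box 4 R →
        Torus.proj n (c + yp) = p.1.1 → Torus.proj n (c + yq) = q.1.1 →
        ‖((spinorLift gammaFive * wilsonDirac (fundamentalRep (Fin 3)) U (-δ) 1).submatrix
            (Subtype.val : {p : TorusSite 4 n × Fin 3 × Fin 4 // P p.1} → _) Subtype.val)⁻¹ p q‖ ≤
          2 / g * Real.exp (-(g / 400 * ((Finset.univ.sup fun i : Fin 4 => (yp i - yq i).natAbs : ℕ) : ℝ))) := by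
  set A := (spinorLift gammaFive * wilsonDirac (fundamentalRep (Fin 3)) U (-δ) 1).submatrix
    (Subtype.val : {p : TorusSite 4 n × Fin 3 × Fin 4 // P p.1} → _) Subtype.val with hA
  -- (1) box coordinates of the indices, unique by `hR`
  choose Y hYbox hYproj using fun p : {p : TorusSite 4 n × Fin 3 × Fin 4 // P p.1} => hP p.1.1 p.2
  have hYeq : ∀ p q : {p : TorusSite 4 n × Fin 3 × Fin 4 // P p.1}, p.1.1 = q.1.1 → Y p = Y q :=
    fun p q h => wallDecay_boxCoord_unique hR c (hYbox p) (hYbox q) (by rw [hYproj p, hYproj q]; exact h)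
  set dist : {p : TorusSite 4 n × Fin 3 × Fin 4 // P p.1} → {p : TorusSite 4 n × Fin 3 × Fin 4 // P p.1} → ℕ :=
    fun p q => Finset.univ.sup fun i : Fin 4 => (Y p i - Y q i).natAbs with hdist
  have hd0 : ∀ p, dist p p = 0 := fun p => wallDecay_supDist_self (Y p)
  have hds : ∀ p q, dist p q = dist q p := fun p q => wallDecay_supDist_comm (Y p) (Y q)
  have hdt : ∀ p q r, dist p r ≤ dist p q + dist q r := fun p q r => wallDecay_supDist_triangle (Y p) (Y q) (Y r)
  have hdY : ∀ p q, p.1.1 = q.1.1 → dist p q = 0 := by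
    intro p q hpq
    show (Finset.univ.sup fun i : Fin 4 => (Y p i - Y q i).natAbs) = 0
    rw [hYeq p q hpq]
    exact wallDecay_supDist_self (Y q)
  have hne : ∀ p q, dist p q ≠ 0 → p.1.1 ≠ q.1.1 := fun p q h hpq => h (hdY p q hpq)
  -- (2) range one and off-site row/column sums `≤ 96`
  have hrange : ∀ p q, A p q ≠ 0 → dist p q ≤ 1 := by
    intro p q hpq
    rw [hA, Matrix.submatrix_apply] at hpq
    rcases schurLoc_H_hop U δ p.1 q.1 hpq with h | ⟨μ, h | h⟩
    · rw [hdY p q h]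
      exact Nat.zero_le 1
    · have hY : Y q = Y p + Pi.single μ 1 :=
        wallDecay_boxCoord_shift hR c (hYbox p) (hYbox q) μ (by rw [hYproj p, hYproj q]; exact h)
      show (Finset.univ.sup fun i : Fin 4 => (Y p i - Y q i).natAbs) ≤ 1
      rw [hY]
      exact wallDecay_supDist_add_single_le (Y p) μ
    · have hY : Y p = Y q + Pi.single μ 1 :=
        wallDecay_boxCoord_shift hR c (hYbox q) (hYbox p) μ (by rw [hYproj p, hYproj q]; exact h)
      rw [hds]
      show (Finset.univ.sup fun i : Fin 4 => (Y q i - Y p i).natAbs) ≤ 1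
      rw [hY]
      exact wallDecay_supDist_add_single_le (Y q) μ
  have hrow : ∀ p, ∑ q ∈ Finset.univ.filter (fun q => dist p q ≠ 0), ‖A p q‖ ≤ 96 := by
    intro p
    simp only [hA, Matrix.submatrix_apply]
    exact schurLoc_rowSum_le U δ p.1 _ fun q hq => hne p q (Finset.mem_filter.1 hq).2
  have hcol : ∀ q, ∑ p ∈ Finset.univ.filter (fun p => dist p q ≠ 0), ‖A p q‖ ≤ 96 := by
    intro q
    simp only [hA, Matrix.submatrix_apply]
    exact schurLoc_colSum_le U δ q.1 _ fun p hp => hne p q (Finset.mem_filter.1 hp).2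
  -- (3) the rate `θ = g / 400`, so that `96 (e^θ − 1) ≤ g / 2`
  set θ : ℝ := g / 400 with hθ
  have hθ0 : 0 ≤ θ := by positivity
  have hθ1 : |θ| ≤ 1 := by rw [abs_of_nonneg hθ0, hθ]; linarith
  have hη : 96 * (Real.exp θ - 1) ≤ g / 2 := by
    have h1 := Real.abs_exp_sub_one_le hθ1
    rw [abs_of_nonneg hθ0, abs_of_nonneg (by linarith [Real.add_one_le_exp θ])] at h1
    rw [hθ] at h1 ⊢
    linarith
  obtain ⟨hdet, hB⟩ := coercive_combes_thomas dist hd0 hds hdt A hrange 96 hrow hcol g θ hg hθ0 hgap hη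
  refine ⟨hdet, fun p q yp yq hyp hyq hp hq => ?_⟩
  have h1 : yp = Y p := wallDecay_boxCoord_unique hR c hyp (hYbox p) (by rw [hp, hYproj p])
  have h2 : yq = Y q := wallDecay_boxCoord_unique hR c hyq (hYbox q) (by rw [hq, hYproj q])
  subst h1 h2
  exact hB p q

/-! ### (2) Lattice geometry of cells, collars and hops -/

omit [NeZero n] in
/-- Torus adjacency of two embedded box points is lattice adjacency of their box coordinates. -/
theorem schurLoc_latticeAdj {R : ℕ} (hR : 2 * R + 1 < n) (c : Fin 4 → ℤ) {Y Y' : Fin 4 → ℤ}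
    (hY : Y ∈ box 4 R) (hY' : Y' ∈ box 4 R)
    (h : Torus.proj n (c + Y) = Torus.proj n (c + Y') ∨ ∃ μ : Fin 4,
      Torus.proj n (c + Y') = Site.shift (Torus.proj n (c + Y)) μ ∨
        Torus.proj n (c + Y) = Site.shift (Torus.proj n (c + Y')) μ) :
    Y = Y' ∨ ∃ μ : Fin 4, Y' = Y + Pi.single μ 1 ∨ Y = Y' + Pi.single μ 1 := by
  rcases h with h | ⟨μ, h | h⟩
  · exact Or.inl (wallDecay_boxCoord_unique hR c hY hY' h)
  · exact Or.inr ⟨μ, Or.inl (wallDecay_boxCoord_shift hR c hY hY' μ h)⟩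
  · exact Or.inr ⟨μ, Or.inr (wallDecay_boxCoord_shift hR c hY' hY μ h)⟩

/-- **Cut geometry.**  A point `z k + y'` of the extended cell `k` (`y' ∈ box (ℓ+W)`) equal or adjacent to a point of another
extended cell lies on the outer face of its cell: `ℓ + W ≤ |y' i|` for some `i`. -/
theorem schurLoc_outerFace {N ℓ W : ℕ} (z : Fin N → Fin 4 → ℤ)
    (hdisj : ∀ k k', k ≠ k' → ∀ (y y' : Fin 4 → ℤ), y ∈ box 4 (ℓ + W) → y' ∈ box 4 (ℓ + W) → z k + y ≠ z k' + y')
    {k k₀ : Fin N} (hk : k₀ ≠ k) {y' y₀ : Fin 4 → ℤ} (hy' : y' ∈ box 4 (ℓ + W)) (hy₀ : y₀ ∈ box 4 (ℓ + W))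
    (hadj : z k₀ + y₀ = z k + y' ∨ ∃ μ : Fin 4,
      z k + y' = z k₀ + y₀ + Pi.single μ 1 ∨ z k₀ + y₀ = z k + y' + Pi.single μ 1) :
    ∃ i, (ℓ + W : ℤ) ≤ |y' i| := by
  by_contra hcon
  have hlt : ∀ i, |y' i| < ℓ + W := fun i => lt_of_not_ge fun h => hcon ⟨i, h⟩
  have hbox : ∀ s : ℤ, s = 1 ∨ s = -1 → ∀ μ : Fin 4, y' + Pi.single μ s ∈ box 4 (ℓ + W) := by
    intro s hs μ
    rw [mem_box]
    intro i
    have h1 := abs_lt.1 (hlt i)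
    rw [Pi.add_apply]
    by_cases hi : i = μ
    · subst hi
      rw [Pi.single_eq_same]
      rcases hs with rfl | rfl <;> constructor <;> push_cast <;> omega
    · rw [Pi.single_eq_of_ne hi]
      constructor <;> push_cast <;> omega
  rcases hadj with h | ⟨μ, h | h⟩
  · exact hdisj k₀ k hk y₀ y' hy₀ hy' h
  · refine hdisj k₀ k hk y₀ (y' + Pi.single μ (-1)) hy₀ (hbox (-1) (Or.inr rfl) μ) ?_
    rw [← add_assoc, h, add_assoc, ← Pi.single_add, add_neg_cancel, Pi.single_zero, add_zero]
  · refine hdisj k₀ k hk y₀ (y' + Pi.single μ 1) hy₀ (hbox 1 (Or.inl rfl) μ) ?_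
    rw [← add_assoc, ← h]

/-- **Cell adjacency.**  A point `z k + y₂` of the extended cell `k` equal or adjacent to a cell point `z k₁ + y₁`
(`y₁ ∈ box ℓ`) satisfies `|y₂ i| ≤ ℓ + 1` for all `i` (and in fact `k = k₁`). -/
theorem schurLoc_cellAdjacent {N ℓ W : ℕ} (hW : 1 ≤ W) (z : Fin N → Fin 4 → ℤ)
    (hdisj : ∀ k k', k ≠ k' → ∀ (y y' : Fin 4 → ℤ), y ∈ box 4 (ℓ + W) → y' ∈ box 4 (ℓ + W) → z k + y ≠ z k' + y')
    {k k₁ : Fin N} {y₁ y₂ : Fin 4 → ℤ} (hy₁ : y₁ ∈ box 4 ℓ) (hy₂ : y₂ ∈ box 4 (ℓ + W))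
    (hadj : z k₁ + y₁ = z k + y₂ ∨ ∃ μ : Fin 4,
      z k + y₂ = z k₁ + y₁ + Pi.single μ 1 ∨ z k₁ + y₁ = z k + y₂ + Pi.single μ 1) :
    ∀ i, |y₂ i| ≤ ℓ + 1 := by
  -- in all cases `z k + y₂ = z k₁ + w` with `|w i| ≤ ℓ + 1`, so `k = k₁` by disjointness and `y₂ = w`
  have key : ∀ w : Fin 4 → ℤ, (∀ i, |w i| ≤ ℓ + 1) → z k + y₂ = z k₁ + w → ∀ i, |y₂ i| ≤ ℓ + 1 := by
    intro w hw h
    have hwbox : w ∈ box 4 (ℓ + W) :=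
      mem_box.2 fun i => by have := abs_le.1 (hw i); constructor <;> push_cast <;> omega
    by_cases hk : k = k₁
    · subst hk
      have : y₂ = w := add_left_cancel h
      subst this
      exact hw
    · exact absurd h (hdisj k k₁ hk y₂ w hy₂ hwbox)
  have hy₁' : ∀ i, |y₁ i| ≤ ℓ := fun i => abs_le.2 ((mem_box.1 hy₁) i)
  have hsingle : ∀ (s : ℤ), s = 1 ∨ s = -1 → ∀ μ i : Fin 4, |(y₁ + Pi.single μ s : Fin 4 → ℤ) i| ≤ ℓ + 1 := by
    intro s hs μ i
    have h1 := abs_le.1 (hy₁' i)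
    rw [Pi.add_apply, abs_le]
    by_cases hi : i = μ
    · subst hi
      rw [Pi.single_eq_same]
      rcases hs with rfl | rfl <;> constructor <;> omega
    · rw [Pi.single_eq_of_ne hi]
      constructor <;> omega
  rcases hadj with h | ⟨μ, h | h⟩
  · exact key y₁ (fun i => (hy₁' i).trans (by omega)) h.symm
  · exact key (y₁ + Pi.single μ 1) (hsingle 1 (Or.inl rfl) μ) (by rw [h, add_assoc])
  · refine key (y₁ + Pi.single μ (-1)) (hsingle (-1) (Or.inr rfl) μ) ?_
    rw [← add_assoc, h, add_assoc, ← Pi.single_add, add_neg_cancel, Pi.single_zero, add_zero]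

/-- The sup-distance between an outer-face point and a cell-adjacent point of a collar is `≥ W − 1`. -/
theorem schurLoc_supDist_ge {ℓ W : ℕ} {y' y₂ : Fin 4 → ℤ} (h1 : ∃ i, (ℓ + W : ℤ) ≤ |y' i|)
    (h2 : ∀ i, |y₂ i| ≤ ℓ + 1) :
    (W : ℝ) - 1 ≤ ((Finset.univ.sup fun i : Fin 4 => (y' i - y₂ i).natAbs : ℕ) : ℝ) := by
  obtain ⟨i, hi⟩ := h1
  have h3 : (y' i - y₂ i).natAbs ≤ Finset.univ.sup fun i : Fin 4 => (y' i - y₂ i).natAbs :=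
    Finset.le_sup (f := fun i => (y' i - y₂ i).natAbs) (Finset.mem_univ i)
  have h4 : W ≤ (Finset.univ.sup fun i : Fin 4 => (y' i - y₂ i).natAbs) + 1 := by
    have h5 : ((y' i - y₂ i).natAbs : ℤ) = |y' i - y₂ i| := Int.natCast_natAbs _
    have h6 := abs_sub_abs_le_abs_sub (y' i) (y₂ i)
    have h7 := h2 i
    omega
  have h8 : (W : ℝ) ≤ ((Finset.univ.sup fun i : Fin 4 => (y' i - y₂ i).natAbs : ℕ) : ℝ) + 1 := by
    exact_mod_cast h4
  linarith

omit [NeZero n] in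
/-- At most `12 (2R+1)⁴` quark indices sit over a site set inside an embedded box of radius `R`. -/
theorem schurLoc_card_le {R : ℕ} (c : Fin 4 → ℤ) (P : TorusSite 4 n → Prop)
    [Fintype {p : TorusSite 4 n × Fin 3 × Fin 4 // P p.1}]
    (hP : ∀ x, P x → ∃ y : Fin 4 → ℤ, y ∈ box 4 R ∧ Torus.proj n (c + y) = x) :
    (Fintype.card {p : TorusSite 4 n × Fin 3 × Fin 4 // P p.1} : ℝ) ≤ 12 * (2 * (R : ℝ) + 1) ^ 4 := by
  choose Y hYbox hYproj using hP
  have hinj : Function.Injective fun p : {p : TorusSite 4 n × Fin 3 × Fin 4 // P p.1} =>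
      ((⟨Y p.1.1 p.2, hYbox p.1.1 p.2⟩ : ↥(box 4 R)), p.1.2) := by
    intro p q h
    simp only [Prod.mk.injEq, Subtype.mk.injEq] at h
    obtain ⟨h1, h2⟩ := h
    apply Subtype.ext
    apply Prod.ext _ h2
    rw [← hYproj p.1.1 p.2, ← hYproj q.1.1 q.2, h1]
  have h := Fintype.card_le_of_injective _ hinj
  rw [Fintype.card_prod, Fintype.card_prod, Fintype.card_coe, card_box, Fintype.card_fin, Fintype.card_fin] at h
  have h' : (Fintype.card {p : TorusSite 4 n × Fin 3 × Fin 4 // P p.1} : ℝ) ≤ ((2 * R + 1) ^ 4 * (3 * 4) : ℕ) := by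
    exact_mod_cast h
  push_cast at h'
  linarith

/-! ### (3) Block-diagonal algebra over a `Σ`-type -/

/-- Off-diagonal blocks of `blockDiagonal'` vanish (index form). -/
theorem schurLoc_blockDiagonal'_apply_of_ne {o : Type*} [DecidableEq o] {m' : o → Type*}
    (G : ∀ k, Matrix (m' k) (m' k) ℂ) : ∀ s t : Σ k, m' k, s.1 ≠ t.1 → blockDiagonal' G s t = 0
  | ⟨_, i⟩, ⟨_, j⟩, h => blockDiagonal'_apply_ne G i j h

/-- Diagonal blocks of `blockDiagonal'` of principal submatrices (index form). -/
theorem schurLoc_blockDiagonal'_submatrix_apply {ι o : Type*} [DecidableEq o] (M : Matrix ι ι ℂ) (P : o → ι → Prop) :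
    ∀ s t : Σ k, {p : ι // P k p}, s.1 = t.1 →
      blockDiagonal' (fun k => M.submatrix (Subtype.val : {p : ι // P k p} → ι) Subtype.val) s t = M s.2.1 t.2.1
  | ⟨_, i⟩, ⟨_, j⟩, rfl => by rw [blockDiagonal'_apply_eq]; rfl

/-- `Σ_{s,t} f s · (⊕_k G_k) s t · g t = Σ_k Σ_{i,j} f ⟨k,i⟩ G_k i j g ⟨k,j⟩`. -/
theorem schurLoc_sum_sigma_blockDiagonal' {o : Type*} [Fintype o] [DecidableEq o] {m' : o → Type*}
    [∀ k, Fintype (m' k)] (G : ∀ k, Matrix (m' k) (m' k) ℂ) (f g : (Σ k, m' k) → ℂ) :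
    ∑ s, ∑ t, f s * blockDiagonal' G s t * g t = ∑ k, ∑ i, ∑ j, f ⟨k, i⟩ * G k i j * g ⟨k, j⟩ := by
  rw [← Finset.univ_sigma_univ, Finset.sum_sigma]
  refine Finset.sum_congr rfl fun k _ => Finset.sum_congr rfl fun i _ => ?_
  rw [Finset.sum_sigma, Finset.sum_eq_single k]
  · exact Finset.sum_congr rfl fun j _ => by rw [blockDiagonal'_apply_eq]
  · intro k' _ hk'
    exact Finset.sum_eq_zero fun j _ => by rw [blockDiagonal'_apply_ne G i j (Ne.symm hk'), mul_zero, zero_mul]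
  · exact fun h => absurd (Finset.mem_univ k) h

end Summit.QuantumFields.QCD.Cruxes.TipPricing.ModularTemplate

end
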